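import Summits.AtomisticToContinuum.HydrodynamicLimit.Theses.JParityClosure
import Literature.MathematicalPhysics.KineticTheory.HardSphereEulerProofs
import HarnessLib

/-!
# Gaussian kernel calculus on `ℝ³` (K1a of P4)

Crux `JParityClosure.OddContactSymmetry` (stmt-AtomisticToContinuum-17722), line `KineticSlabSketch`,
registered stub `stub_gaussKernelMoments` (piece K1a of P4 `stub_maxwellDefectFlux`): three closed-form
Gaussian integrals on `V3 = ℝ³` against the isotropic Gaussian law `γ_θ = gaussMeasure 0 θ = N(0, θ id)`,
whose Lebesgue density is the local Maxwellian `M_{1,0,θ}` (`withDensity_localMaxwellian_eq_gaussMeasure`):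

1. the Gaussian kernel smoothed by a Gaussian is a Gaussian,
   `∫ M_{1,q,s}(v) γ_θ(dv) = M_{1,0,θ+s}(q)` (semigroup / Chapman–Kolmogorov identity of the heat kernel);
2. its second moment, `∫ M_{1,q,s}(v)² γ_θ(dv) = (4πs)^{-3/2} M_{1,0,θ+s/2}(q)`;
3. the exponential moment `∫ e^{c|v|²} γ_θ(dv) = (1 − 2cθ)^{-3/2}` for `c < 1/(2θ)`.

Proof: no Fourier or convolution theory.  Each identity is a POINTWISE "complete the square" identity
between products of Maxwellians,

* `M_{1,0,θ}(v) M_{1,q,s}(v) = M_{1,0,θ+s}(q) · M_{1,αq,β}(v)` with `α = θ/(θ+s)`, `β = θs/(θ+s)`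
  (`localMaxwellian_mul_localMaxwellian`),
* `M_{1,q,s}(v)² = (4πs)^{-3/2} M_{1,q,s/2}(v)` (`localMaxwellian_sq`),
* `M_{1,0,θ}(v) e^{c|v|²} = (1 − 2cθ)^{-3/2} M_{1,0,θ/(1−2cθ)}(v)` (`localMaxwellian_mul_exp`),

followed by the unit mass of the local Maxwellian (`integral_localMaxwellian_one`), after the density
formula `∫ g dγ_θ = ∫ M_{1,0,θ}(v) g(v) dv` (`integral_gaussMeasure_zero_eq`,
`integral_withDensity_eq_integral_toReal_smul₀`).
-/

noncomputable section

open scoped BigOperators Classical InnerProductSpace ENNReal Topology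
open Set MeasureTheory Filter
open Literature.Analysis.FluidPDE Literature.MathematicalPhysics.KineticTheory

namespace Summit.AtomisticToContinuum.HydrodynamicLimit.Theorems.OddContactSymmetryKineticSlab

/-! ### The density formula -/

/-- Integration against the centred isotropic Gaussian `γ_θ = gaussMeasure 0 θ` on `ℝ³` is Lebesgue
integration against the local Maxwellian density `M_{1,0,θ}` (`θ > 0`; no integrability needed, both
sides are the same Bochner integral). [folklore] -/
theorem integral_gaussMeasure_zero_eq {θ : ℝ} (hθ : 0 < θ) (g : V3 → ℝ) :
    ∫ v, g v ∂gaussMeasure (0 : V3) θ = ∫ v, localMaxwellian 1 θ 0 v * g v := by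
  rw [← withDensity_localMaxwellian_eq_gaussMeasure hθ,
    integral_withDensity_eq_integral_toReal_smul₀
      (continuous_localMaxwellian 1 θ 0).measurable.ennreal_ofReal.aemeasurable
      (Eventually.of_forall fun _ => ENNReal.ofReal_lt_top)]
  refine integral_congr_ae (Eventually.of_forall fun v => ?_)
  simp only [smul_eq_mul, ENNReal.toReal_ofReal (localMaxwellian_nonneg zero_le_one hθ.le _ _)]

/-! ### Pointwise "complete the square" identities -/

/-- **Product of two Maxwellians on `ℝ³`.** For `θ, s > 0`,
`M_{1,0,θ}(v) · M_{1,q,s}(v) = M_{1,0,θ+s}(q) · M_{1,αq,β}(v)` with `α = θ/(θ+s)`, `β = θs/(θ+s)`: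
the exponents satisfy `|v|²/θ + |v−q|²/s = |q|²/(θ+s) + |v − αq|²/β` and the prefactors
`(2πθ)(2πs) = (2π(θ+s))(2πβ)`. [folklore] -/
theorem localMaxwellian_mul_localMaxwellian {θ s : ℝ} (hθ : 0 < θ) (hs : 0 < s) (q v : V3) :
    localMaxwellian 1 θ 0 v * localMaxwellian 1 s q v =
      localMaxwellian 1 (θ + s) 0 q *
        localMaxwellian 1 (θ * s / (θ + s)) ((θ / (θ + s)) • q) v := by
  have hπ : 0 < Real.pi := Real.pi_pos
  have hθs : 0 < θ + s := add_pos hθ hs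
  have hβ : 0 < θ * s / (θ + s) := div_pos (mul_pos hθ hs) hθs
  simp only [localMaxwellian, finrank_euclideanSpace_fin, sub_zero, one_mul]
  have hr : (2 * Real.pi * θ) ^ (-((3 : ℕ) : ℝ) / 2) * (2 * Real.pi * s) ^ (-((3 : ℕ) : ℝ) / 2) =
      (2 * Real.pi * (θ + s)) ^ (-((3 : ℕ) : ℝ) / 2) *
        (2 * Real.pi * (θ * s / (θ + s))) ^ (-((3 : ℕ) : ℝ) / 2) := by
    rw [← Real.mul_rpow (by positivity) (by positivity),
      ← Real.mul_rpow (by positivity) (by positivity)]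
    congr 1
    field_simp
  have he : Real.exp (-‖v‖ ^ 2 / (2 * θ)) * Real.exp (-‖v - q‖ ^ 2 / (2 * s)) =
      Real.exp (-‖q‖ ^ 2 / (2 * (θ + s))) *
        Real.exp (-‖v - (θ / (θ + s)) • q‖ ^ 2 / (2 * (θ * s / (θ + s)))) := by
    rw [← Real.exp_add, ← Real.exp_add]
    congr 1
    rw [norm_sub_sq_real, norm_sub_sq_real, real_inner_smul_right, norm_smul, Real.norm_eq_abs,
      mul_pow, sq_abs]
    field_simp
    ring
  calc (2 * Real.pi * θ) ^ (-((3 : ℕ) : ℝ) / 2) * Real.exp (-‖v‖ ^ 2 / (2 * θ)) *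
        ((2 * Real.pi * s) ^ (-((3 : ℕ) : ℝ) / 2) * Real.exp (-‖v - q‖ ^ 2 / (2 * s)))
      = ((2 * Real.pi * θ) ^ (-((3 : ℕ) : ℝ) / 2) * (2 * Real.pi * s) ^ (-((3 : ℕ) : ℝ) / 2)) *
        (Real.exp (-‖v‖ ^ 2 / (2 * θ)) * Real.exp (-‖v - q‖ ^ 2 / (2 * s))) := by ring
    _ = _ := by rw [hr, he]; ring

/-- **Square of a Maxwellian on `ℝ³`.** `M_{1,q,s}(v)² = (4πs)^{-3/2} · M_{1,q,s/2}(v)` for `s > 0`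
(`(2πs)² = (4πs)(2π·s/2)` and `2 · |v−q|²/(2s) = |v−q|²/(2·s/2)`). [folklore] -/
theorem localMaxwellian_sq {s : ℝ} (hs : 0 < s) (q v : V3) :
    localMaxwellian 1 s q v ^ 2 =
      (4 * Real.pi * s) ^ (-(3 : ℝ) / 2) * localMaxwellian 1 (s / 2) q v := by
  have hπ : 0 < Real.pi := Real.pi_pos
  simp only [localMaxwellian, finrank_euclideanSpace_fin, one_mul]
  push_cast
  have hr : (2 * Real.pi * s) ^ (-(3 : ℝ) / 2) * (2 * Real.pi * s) ^ (-(3 : ℝ) / 2) =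
      (4 * Real.pi * s) ^ (-(3 : ℝ) / 2) * (2 * Real.pi * (s / 2)) ^ (-(3 : ℝ) / 2) := by
    rw [← Real.mul_rpow (by positivity) (by positivity),
      ← Real.mul_rpow (by positivity) (by positivity)]
    congr 1
    ring
  have he : Real.exp (-‖v - q‖ ^ 2 / (2 * s)) * Real.exp (-‖v - q‖ ^ 2 / (2 * s)) =
      Real.exp (-‖v - q‖ ^ 2 / (2 * (s / 2))) := by
    rw [← Real.exp_add]
    congr 1
    field_simp
    ring
  calc ((2 * Real.pi * s) ^ (-(3 : ℝ) / 2) * Real.exp (-‖v - q‖ ^ 2 / (2 * s))) ^ 2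
      = ((2 * Real.pi * s) ^ (-(3 : ℝ) / 2) * (2 * Real.pi * s) ^ (-(3 : ℝ) / 2)) *
        (Real.exp (-‖v - q‖ ^ 2 / (2 * s)) * Real.exp (-‖v - q‖ ^ 2 / (2 * s))) := by ring
    _ = _ := by rw [hr, he, mul_assoc]

/-- For `c < 1/(2θ)` and `θ > 0` the tilt factor `1 − 2cθ` is positive. [folklore] -/
theorem one_sub_two_mul_mul_pos {θ c : ℝ} (hθ : 0 < θ) (hc : c < 1 / (2 * θ)) :
    0 < 1 - 2 * c * θ := by
  have h : c * (2 * θ) < 1 := (lt_div_iff₀ (by positivity)).1 hc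
  nlinarith

/-- **Gaussian tilt of a Maxwellian on `ℝ³`.** For `θ > 0` and `c < 1/(2θ)`,
`M_{1,0,θ}(v) · e^{c|v|²} = (1 − 2cθ)^{-3/2} · M_{1,0,θ/(1−2cθ)}(v)`
(`−|v|²/(2θ) + c|v|² = −|v|²(1−2cθ)/(2θ)` and `(1−2cθ) · 2πθ/(1−2cθ) = 2πθ`). [folklore] -/
theorem localMaxwellian_mul_exp {θ c : ℝ} (hθ : 0 < θ) (hc : c < 1 / (2 * θ)) (v : V3) :
    localMaxwellian 1 θ 0 v * Real.exp (c * ‖v‖ ^ 2) =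
      (1 - 2 * c * θ) ^ (-(3 : ℝ) / 2) * localMaxwellian 1 (θ / (1 - 2 * c * θ)) 0 v := by
  have hπ : 0 < Real.pi := Real.pi_pos
  have hκ : 0 < 1 - 2 * c * θ := one_sub_two_mul_mul_pos hθ hc
  have hκ' : (1 - 2 * c * θ) ≠ 0 := hκ.ne'
  simp only [localMaxwellian, finrank_euclideanSpace_fin, one_mul, sub_zero]
  push_cast
  have hr : (1 - 2 * c * θ) ^ (-(3 : ℝ) / 2) * (2 * Real.pi * (θ / (1 - 2 * c * θ))) ^ (-(3 : ℝ) / 2) =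
      (2 * Real.pi * θ) ^ (-(3 : ℝ) / 2) := by
    rw [← Real.mul_rpow hκ.le (by positivity)]
    congr 1
    field_simp
  have he : Real.exp (-‖v‖ ^ 2 / (2 * θ)) * Real.exp (c * ‖v‖ ^ 2) =
      Real.exp (-‖v‖ ^ 2 / (2 * (θ / (1 - 2 * c * θ)))) := by
    rw [← Real.exp_add]
    congr 1
    field_simp
    ring
  calc (2 * Real.pi * θ) ^ (-(3 : ℝ) / 2) * Real.exp (-‖v‖ ^ 2 / (2 * θ)) * Real.exp (c * ‖v‖ ^ 2)
      = (2 * Real.pi * θ) ^ (-(3 : ℝ) / 2) *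
          (Real.exp (-‖v‖ ^ 2 / (2 * θ)) * Real.exp (c * ‖v‖ ^ 2)) := by ring
    _ = _ := by rw [← hr, he, mul_assoc]

/-! ### The three Gaussian integrals -/

/-- **Gaussian smoothing of the Gaussian kernel** (heat-kernel semigroup identity on `ℝ³`):
`∫ M_{1,q,s}(v) γ_θ(dv) = M_{1,0,θ+s}(q)` for `θ, s > 0`. [folklore] -/
theorem integral_localMaxwellian_gaussMeasure {θ s : ℝ} (hθ : 0 < θ) (hs : 0 < s) (q : V3) :
    ∫ v, localMaxwellian 1 s q v ∂gaussMeasure (0 : V3) θ = localMaxwellian 1 (θ + s) 0 q := by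
  rw [integral_gaussMeasure_zero_eq hθ]
  simp_rw [localMaxwellian_mul_localMaxwellian hθ hs q]
  rw [integral_const_mul,
    integral_localMaxwellian_one (div_pos (mul_pos hθ hs) (add_pos hθ hs)), mul_one]

/-- **Second moment of the Gaussian kernel under a Gaussian**:
`∫ M_{1,q,s}(v)² γ_θ(dv) = (4πs)^{-3/2} M_{1,0,θ+s/2}(q)` for `θ, s > 0`. [folklore] -/
theorem integral_localMaxwellian_sq_gaussMeasure {θ s : ℝ} (hθ : 0 < θ) (hs : 0 < s) (q : V3) :
    ∫ v, localMaxwellian 1 s q v ^ 2 ∂gaussMeasure (0 : V3) θ =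
      (4 * Real.pi * s) ^ (-(3 : ℝ) / 2) * localMaxwellian 1 (θ + s / 2) 0 q := by
  simp_rw [localMaxwellian_sq hs q]
  rw [integral_const_mul, integral_localMaxwellian_gaussMeasure hθ (half_pos hs) q]

/-- **Exponential moments of the isotropic Gaussian on `ℝ³`**:
`∫ e^{c|v|²} γ_θ(dv) = (1 − 2cθ)^{-3/2}` for `θ > 0`, `c < 1/(2θ)`. [folklore] -/
theorem integral_exp_mul_norm_sq_gaussMeasure {θ c : ℝ} (hθ : 0 < θ) (hc : c < 1 / (2 * θ)) :
    ∫ v, Real.exp (c * ‖v‖ ^ 2) ∂gaussMeasure (0 : V3) θ = (1 - 2 * c * θ) ^ (-(3 : ℝ) / 2) := by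
  rw [integral_gaussMeasure_zero_eq hθ]
  simp_rw [localMaxwellian_mul_exp hθ hc]
  rw [integral_const_mul,
    integral_localMaxwellian_one (div_pos hθ (one_sub_two_mul_mul_pos hθ hc)), mul_one]

/-- **K1a: Gaussian kernel calculus on `ℝ³`** (registered stub `stub_gaussKernelMoments` of line
`KineticSlabSketch`, crux `JParityClosure.OddContactSymmetry`).  For `θ, s > 0`, `q ∈ ℝ³` and
`γ_θ = gaussMeasure 0 θ`: (1) `∫ M_{1,q,s} dγ_θ = M_{1,0,θ+s}(q)`; (2)
`∫ M_{1,q,s}² dγ_θ = (4πs)^{-3/2} M_{1,0,θ+s/2}(q)`; (3) `∫ e^{c|v|²} dγ_θ = (1 − 2cθ)^{-3/2}` for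
every `c < 1/(2θ)`. [folklore] -/
theorem stub_gaussKernelMoments :
    ∀ {θ s : ℝ} (_hθ : 0 < θ) (_hs : 0 < s) (q : V3),
    (∫ v, localMaxwellian 1 s q v ∂gaussMeasure (0 : V3) θ = localMaxwellian 1 (θ + s) 0 q) ∧
    (∫ v, localMaxwellian 1 s q v ^ 2 ∂gaussMeasure (0 : V3) θ =
        (4 * Real.pi * s) ^ (-(3 : ℝ) / 2) * localMaxwellian 1 (θ + s / 2) 0 q) ∧
    (∀ c : ℝ, c < 1 / (2 * θ) →
      ∫ v, Real.exp (c * ‖v‖ ^ 2) ∂gaussMeasure (0 : V3) θ = (1 - 2 * c * θ) ^ (-(3 : ℝ) / 2)) :=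
  fun hθ hs q => ⟨integral_localMaxwellian_gaussMeasure hθ hs q,
    integral_localMaxwellian_sq_gaussMeasure hθ hs q,
    fun _ hc => integral_exp_mul_norm_sq_gaussMeasure hθ hc⟩

end Summit.AtomisticToContinuum.HydrodynamicLimit.Theorems.OddContactSymmetryKineticSlab

end
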